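import Summits.ResolutionOfSingularities.ResolutionOfSingularities.Theorems.HilbertSamuelEliminationCampaignW42VertexGame
import Mathlib.Data.Fin.VecNotation
import Mathlib.Data.Fintype.Fin
import Mathlib.Data.Finset.Max
import Mathlib.Order.WellFounded
import Mathlib.Tactic.IntervalCases

/-!
# [OURS · L1 W4.2] The TWO-vertex game: the CJS label strategy LOSES Hironaka's two-vertex polyhedra game in dimension 3 —
# an explicit INFINITE play from an honest start (kernel twin of KILL-CANDIDATE-W42-trinomial.md)
# `--kind definition --supports stmt-ResolutionOfSingularities-19964`; campaign s42 of cell res-hironaka (LADDER-RESOLUTION rung L, D-0089)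

HONEST FRAMING. OURS (seat res-L1-s42-pv-2, slot W4.2 / obstruction O2); nothing here is a statement of H. Hironaka's manuscript
[Hironaka2017]; AI-made, AI review is weaker than expert review. A theorem about the combinatorial MODEL of the CJS-architecture
canonical walk on the threefolds `X = V(y^m + x^A + x^B) ⊂ 𝔸⁴` followed at torus-fixed closed points (two monomials = two vertices
`A/m`, `B/m` of the characteristic polyhedron; no vertex solvable): components of the multiplicity-`m` locus through the point =
inclusion-minimal `S` with `A_S ≥ m` AND `B_S ≥ m`; the chart `c` of the blow-up of `V(y, x_U)` sends `A_c ↦ A_U − m`, `B_c ↦ B_U − m`;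
CJS bookkeeping as in the one-vertex game (`…CampaignW42VertexGame.lean`, p510005, whose `transform` is reused). The model was checked
against the chain's Gröbner engine (res-L0-k42 `k42_hswalk.py` v7, unchanged) on the very specimen below: 2 682 chart-origin edges of a
6 000-node tree, 0 discrepancies (kit j273490), and the non-coordinate part of the multiplicity-3 locus never passes through a tracked
point (seat memo KILL-CANDIDATE-W42-trinomial.md §3). It is NOT a theorem about schemes; the dictionary model ↔ `IsCanonicalStep` on
this `X` is evidence-level (engine), not kernel-level.

MAIN RESULT. `exists_infinite_play₂` / `not_labelStrategyWins₂_three`: for `m = 3` the play from the HONEST initial position of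
`y³ + x₃⁵ + x₁⁶x₂⁶x₃` (vertices `(0,0,5)`, `(6,6,1)`, all labels `0`; components the two lines `V(y,x₁,x₃)`, `V(y,x₂,x₃)`) that follows
the charts `x₁,x₂,x₂,x₂,x₁,x₁,x₃,x₂,x₂,x₂,x₃,x₂,x₁,x₂,x₁,x₃` reaches after 16 moves the position `(8,1,4), (4,5,2)` with the line
`V(y,x₂,x₃)` OLDER than the plane `V(y,x₁)`, and from there the 8 moves (charts `x₃,x₂,x₁,x₂,x₃,x₁,x₂,x₁`) return to the SAME exponents
with the SAME label order (every label raised by `4`): an infinite play. Hence `¬ LabelStrategyWins₂ 3` — in contrast with the one-vertex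
(binomial) game, which the strategy wins (`labelStrategyWins`, p511912). Read back through the (evidence-level) dictionary this is the
chain's k13-type CANDIDATE KILL of the non-pointed CORE row / of `CampaignW42.NearChainTermination p` for the intended oracle; it does
not touch isolated origins (`CampaignW42.TertiaryTermination`, the pointed row), where the model cannot loop.
-/

set_option linter.dupNamespace false -- mandated namespace of this single-conjunct summit

namespace Summit.ResolutionOfSingularities.ResolutionOfSingularities.Theorems

namespace CampaignW42.VertexGame

open Finset

/-! ## The two-vertex game -/

/-- [OURS · L1 W4.2] A position of the two-vertex game: the exponent vectors `A`, `B` of the two monomials of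
`y^m + x^A + x^B` at the tracked torus-fixed point, and the CJS label book. [folklore] -/
structure State₂ where
  /-- exponents of the first monomial -/
  A : Fin 3 → ℕ
  /-- exponents of the second monomial -/
  B : Fin 3 → ℕ
  /-- label book (values on non-components irrelevant) -/
  lab : Finset (Fin 3) → ℕ

/-- [OURS · L1 W4.2] Components through the point: inclusion-minimal nonempty `S` with `A_S ≥ m` and `B_S ≥ m` (the coordinate
subspaces `V(y, x_S)` inside the multiplicity-`m` locus of `y^m + x^A + x^B`). [folklore] -/
def comps₂ (m : ℕ) (A B : Fin 3 → ℕ) : Finset (Finset (Fin 3)) :=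
  (Finset.univ : Finset (Finset (Fin 3))).filter fun S =>
    S.Nonempty ∧ m ≤ ∑ i ∈ S, A i ∧ m ≤ ∑ i ∈ S, B i ∧
      ∀ T ∈ S.ssubsets, T.Nonempty → (∑ i ∈ T, A i < m ∨ ∑ i ∈ T, B i < m)

/-- [OURS · L1 W4.2] The oldest class (least label among the components through the point). [folklore] -/
def leastClass₂ (m : ℕ) (s : State₂) : Finset (Finset (Fin 3)) :=
  (comps₂ m s.A s.B).filter fun S => ∀ T ∈ comps₂ m s.A s.B, s.lab S ≤ s.lab T

/-- [OURS · L1 W4.2] A fresh label (newer than every current component's). [folklore] -/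
def fresh₂ (m : ℕ) (s : State₂) : ℕ :=
  (comps₂ m s.A s.B).sup s.lab + 1

/-- [OURS · L1 W4.2] The CJS centre: the single oldest component (`END`), or a flat of the arrangement of ≥ 2 oldest
components (`ARR`, `U` = union of their index sets). [folklore] -/
inductive IsCentre₂ (m : ℕ) (s : State₂) : Bool → Finset (Fin 3) → Prop
  | end_ (S₀ : Finset (Fin 3)) (h : leastClass₂ m s = {S₀}) : IsCentre₂ m s true S₀
  | arr (sub : Finset (Finset (Fin 3))) (hsub : sub ⊆ leastClass₂ m s) (hcard : 2 ≤ sub.card) :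
      IsCentre₂ m s false (sub.biUnion id)

/-- [OURS · L1 W4.2] CJS bookkeeping for a component `S` of the new position (same rule as the one-vertex game). [folklore] -/
def newLabel₂ (m : ℕ) (s : State₂) (isEnd : Bool) (U : Finset (Fin 3)) (c : Fin 3) (S : Finset (Fin 3)) : ℕ :=
  if c ∉ S then s.lab S else if isEnd = true ∧ S ⊆ U then s.lab U else fresh₂ m s

/-- [OURS · L1 W4.2] One move of the two-vertex game followed into one chart (both exponent vectors transform). [folklore] -/
def Step₂ (m : ℕ) (s s' : State₂) : Prop :=
  ∃ (isEnd : Bool) (U : Finset (Fin 3)) (c : Fin 3), IsCentre₂ m s isEnd U ∧ c ∈ U ∧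
    s'.A = transform m s.A U c ∧ s'.B = transform m s.B U c ∧
    ∀ S ∈ comps₂ m s'.A s'.B, s'.lab S = newLabel₂ m s isEnd U c S

/-- [OURS · L1 W4.2] «The CJS label strategy wins the two-vertex polyhedra game in dimension 3»: no infinite play. REFUTED for
`m = 3` below (`not_labelStrategyWins₂_three`). [folklore] -/
def LabelStrategyWins₂ (m : ℕ) : Prop :=
  WellFounded (flip (Step₂ m))

/-- [OURS · L1 W4.2] Raising every label by `k` (the positions of an eventually periodic play differ by such shifts). [folklore] -/
def State₂.addLabels (s : State₂) (k : ℕ) : State₂ :=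
  ⟨s.A, s.B, fun S => s.lab S + k⟩

/-! ## Raising all labels does not change the game -/

/-- The oldest class is invariant under raising all labels. [folklore] -/
theorem leastClass₂_addLabels (m : ℕ) (s : State₂) (k : ℕ) : leastClass₂ m (s.addLabels k) = leastClass₂ m s := by
  ext S
  simp only [leastClass₂, State₂.addLabels, mem_filter, Nat.add_le_add_iff_right]

/-- The fresh label rises with the labels (nonempty component set). [folklore] -/
theorem fresh₂_addLabels (m : ℕ) (s : State₂) (k : ℕ) (h : (comps₂ m s.A s.B).Nonempty) :
    fresh₂ m (s.addLabels k) = fresh₂ m s + k := by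
  have hsup : (comps₂ m s.A s.B).sup (fun S => s.lab S + k) = (comps₂ m s.A s.B).sup s.lab + k := by
    apply le_antisymm
    · exact Finset.sup_le fun S hS => Nat.add_le_add_right (Finset.le_sup (f := s.lab) hS) k
    · obtain ⟨S₀, hS₀, hsup⟩ := Finset.exists_mem_eq_sup _ h s.lab
      rw [hsup]
      exact Finset.le_sup (f := fun S => s.lab S + k) hS₀
  simp only [fresh₂, State₂.addLabels]
  rw [hsup]
  omega

/-- Centres are invariant under raising all labels. [folklore] -/
theorem isCentre₂_addLabels {m : ℕ} {s : State₂} {isEnd : Bool} {U : Finset (Fin 3)} (k : ℕ)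
    (h : IsCentre₂ m s isEnd U) : IsCentre₂ m (s.addLabels k) isEnd U := by
  cases h with
  | end_ _ hLC => exact IsCentre₂.end_ _ (by rw [leastClass₂_addLabels]; exact hLC)
  | arr sub hsub hcard => exact IsCentre₂.arr sub (by rw [leastClass₂_addLabels]; exact hsub) hcard

/-- A centre exists only at an unresolved position. [folklore] -/
theorem comps₂_nonempty_of_isCentre₂ {m : ℕ} {s : State₂} {isEnd : Bool} {U : Finset (Fin 3)}
    (h : IsCentre₂ m s isEnd U) : (comps₂ m s.A s.B).Nonempty := by
  cases h with
  | end_ _ hLC =>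
    have h1 : (leastClass₂ m s).Nonempty := by rw [hLC]; exact singleton_nonempty _
    obtain ⟨X, hX⟩ := h1
    exact ⟨X, (mem_filter.1 hX).1⟩
  | arr sub hsub hcard =>
    obtain ⟨S, hS⟩ := card_pos.1 (by omega : 0 < sub.card)
    exact ⟨S, (mem_filter.1 (hsub hS)).1⟩

/-- The bookkeeping rises with the labels (nonempty component set). [folklore] -/
theorem newLabel₂_addLabels (m : ℕ) (s : State₂) (k : ℕ) (isEnd : Bool) (U : Finset (Fin 3)) (c : Fin 3)
    (S : Finset (Fin 3)) (hne : (comps₂ m s.A s.B).Nonempty) :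
    newLabel₂ m (s.addLabels k) isEnd U c S = newLabel₂ m s isEnd U c S + k := by
  by_cases h1 : c ∉ S
  · simp [newLabel₂, h1, State₂.addLabels]
  · by_cases h2 : isEnd = true ∧ S ⊆ U
    · rw [newLabel₂, newLabel₂, if_neg h1, if_neg h1, if_pos h2, if_pos h2]; rfl
    · rw [newLabel₂, newLabel₂, if_neg h1, if_neg h1, if_neg h2, if_neg h2, fresh₂_addLabels m s k hne]

/-- **Moves are invariant under raising all labels** (by the same amount before and after). [folklore] -/
theorem step₂_addLabels {m : ℕ} {s s' : State₂} (k : ℕ) (h : Step₂ m s s') :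
    Step₂ m (s.addLabels k) (s'.addLabels k) := by
  obtain ⟨isEnd, U, c, hcen, hcU, hA, hB, hlab⟩ := h
  have hne := comps₂_nonempty_of_isCentre₂ hcen
  refine ⟨isEnd, U, c, isCentre₂_addLabels k hcen, hcU, hA, hB, fun S hS => ?_⟩
  have hS' : S ∈ comps₂ m s'.A s'.B := hS
  show s'.lab S + k = newLabel₂ m (s.addLabels k) isEnd U c S
  rw [hlab S hS', newLabel₂_addLabels m s k isEnd U c S hne]

/-- Raising by `a` then by `b` is raising by `a + b`. [folklore] -/
theorem addLabels_addLabels (s : State₂) (a b : ℕ) : (s.addLabels a).addLabels b = s.addLabels (a + b) := by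
  simp only [State₂.addLabels, Nat.add_assoc]

/-- Raising by `0`. [folklore] -/
theorem addLabels_zero (s : State₂) : s.addLabels 0 = s := by
  cases s; simp [State₂.addLabels]

/-! ## The witness play: `y³ + x₃⁵ + x₁⁶x₂⁶x₃`, sixteen moves into an eight-move cycle -/

/-- Position 16 of the witness play (= position 24 with all labels lowered by `4`): `y³ + x₁⁸x₂x₃⁴ + x₁⁴x₂⁵x₃²` with the line
`V(y,x₂,x₃)` (label `6`) OLDER than the plane `V(y,x₁)` (label `7`). [folklore] -/
def P16 : State₂ := ⟨![8, 1, 4], ![4, 5, 2], fun S => if S = {0} then 7 else if S = {1, 2} then 6 else 0⟩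

/-- The 25 positions `P 0, …, P 24` of the witness play (exponent pairs and label books; `P 24` = `P 16` with every label
raised by `4`; positions beyond `24` are junk and unused). [folklore] -/
def P : ℕ → State₂
  | 0 => ⟨![0, 0, 5], ![6, 6, 1], fun _ => 0⟩
  | 1 => ⟨![2, 0, 5], ![10, 6, 1], fun S => if S = {0, 2} then 1 else if S = {1, 2} then 0 else 0⟩
  | 2 => ⟨![2, 2, 5], ![10, 4, 1], fun S => if S = {0, 1} then 2 else if S = {0, 2} then 1 else if S = {1, 2} then 0 else 0⟩
  | 3 => ⟨![2, 4, 5], ![10, 2, 1], fun S => if S = {0, 1} then 3 else if S = {0, 2} then 1 else if S = {1, 2} then 0 else 0⟩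
  | 4 => ⟨![2, 6, 5], ![10, 0, 1], fun S => if S = {0, 1} then 4 else if S = {0, 2} then 1 else 0⟩
  | 5 => ⟨![4, 6, 5], ![8, 0, 1], fun S => if S = {0} then 1 else 0⟩
  | 6 => ⟨![1, 6, 5], ![5, 0, 1], fun S => if S = {0, 1} then 2 else if S = {0, 2} then 2 else 0⟩
  | 7 => ⟨![1, 6, 9], ![5, 0, 3], fun S => if S = {0, 1} then 2 else if S = {2} then 3 else 0⟩
  | 8 => ⟨![1, 4, 9], ![5, 2, 3], fun S => if S = {0, 1} then 2 else if S = {2} then 3 else 0⟩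
  | 9 => ⟨![1, 2, 9], ![5, 4, 3], fun S => if S = {0, 1} then 2 else if S = {2} then 3 else 0⟩
  | 10 => ⟨![1, 0, 9], ![5, 6, 3], fun S => if S = {2} then 3 else 0⟩
  | 11 => ⟨![1, 0, 6], ![5, 6, 0], fun S => if S = {0, 2} then 4 else if S = {1, 2} then 4 else 0⟩
  | 12 => ⟨![1, 4, 6], ![5, 8, 0], fun S => if S = {0, 2} then 4 else if S = {1} then 5 else 0⟩
  | 13 => ⟨![4, 4, 6], ![2, 8, 0], fun S => if S = {1} then 5 else 0⟩
  | 14 => ⟨![4, 1, 6], ![2, 5, 0], fun S => if S = {0, 1} then 6 else if S = {1, 2} then 6 else 0⟩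
  | 15 => ⟨![8, 1, 6], ![4, 5, 0], fun S => if S = {0} then 7 else if S = {1, 2} then 6 else 0⟩
  | 16 => P16
  | 17 => ⟨![8, 1, 2], ![4, 5, 4], fun S => if S = {0} then 7 else if S = {1, 2} then 6 else 0⟩
  | 18 => ⟨![8, 0, 2], ![4, 6, 4], fun S => if S = {0} then 7 else 0⟩
  | 19 => ⟨![5, 0, 2], ![1, 6, 4], fun S => if S = {0, 1} then 8 else if S = {0, 2} then 8 else 0⟩
  | 20 => ⟨![5, 4, 2], ![1, 8, 4], fun S => if S = {0, 2} then 8 else if S = {1} then 9 else 0⟩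
  | 21 => ⟨![5, 4, 4], ![1, 8, 2], fun S => if S = {0, 2} then 8 else if S = {1} then 9 else 0⟩
  | 22 => ⟨![6, 4, 4], ![0, 8, 2], fun S => if S = {1} then 9 else 0⟩
  | 23 => ⟨![6, 1, 4], ![0, 5, 2], fun S => if S = {0, 1} then 10 else if S = {1, 2} then 10 else 0⟩
  | 24 => P16.addLabels 4
  | _ => ⟨![0, 0, 0], ![0, 0, 0], fun _ => 0⟩

/-- Move 0 → 1 of the witness play (ARR into chart `0`). [folklore] -/
theorem step_P_0 : Step₂ 3 (P 0) (P 1) :=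
  ⟨false, _, 0, IsCentre₂.arr {{0, 2}, {1, 2}} (by decide) (by decide), by decide, by decide, by decide, by decide⟩

/-- Move 1 → 2 of the witness play (END into chart `1`). [folklore] -/
theorem step_P_1 : Step₂ 3 (P 1) (P 2) :=
  ⟨true, _, 1, IsCentre₂.end_ {1, 2} (by decide), by decide, by decide, by decide, by decide⟩

/-- Move 2 → 3 of the witness play (END into chart `1`). [folklore] -/
theorem step_P_2 : Step₂ 3 (P 2) (P 3) :=
  ⟨true, _, 1, IsCentre₂.end_ {1, 2} (by decide), by decide, by decide, by decide, by decide⟩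

/-- Move 3 → 4 of the witness play (END into chart `1`). [folklore] -/
theorem step_P_3 : Step₂ 3 (P 3) (P 4) :=
  ⟨true, _, 1, IsCentre₂.end_ {1, 2} (by decide), by decide, by decide, by decide, by decide⟩

/-- Move 4 → 5 of the witness play (END into chart `0`). [folklore] -/
theorem step_P_4 : Step₂ 3 (P 4) (P 5) :=
  ⟨true, _, 0, IsCentre₂.end_ {0, 2} (by decide), by decide, by decide, by decide, by decide⟩

/-- Move 5 → 6 of the witness play (END into chart `0`). [folklore] -/
theorem step_P_5 : Step₂ 3 (P 5) (P 6) :=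
  ⟨true, _, 0, IsCentre₂.end_ {0} (by decide), by decide, by decide, by decide, by decide⟩

/-- Move 6 → 7 of the witness play (ARR into chart `2`). [folklore] -/
theorem step_P_6 : Step₂ 3 (P 6) (P 7) :=
  ⟨false, _, 2, IsCentre₂.arr {{0, 1}, {0, 2}} (by decide) (by decide), by decide, by decide, by decide, by decide⟩

/-- Move 7 → 8 of the witness play (END into chart `1`). [folklore] -/
theorem step_P_7 : Step₂ 3 (P 7) (P 8) :=
  ⟨true, _, 1, IsCentre₂.end_ {0, 1} (by decide), by decide, by decide, by decide, by decide⟩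

/-- Move 8 → 9 of the witness play (END into chart `1`). [folklore] -/
theorem step_P_8 : Step₂ 3 (P 8) (P 9) :=
  ⟨true, _, 1, IsCentre₂.end_ {0, 1} (by decide), by decide, by decide, by decide, by decide⟩

/-- Move 9 → 10 of the witness play (END into chart `1`). [folklore] -/
theorem step_P_9 : Step₂ 3 (P 9) (P 10) :=
  ⟨true, _, 1, IsCentre₂.end_ {0, 1} (by decide), by decide, by decide, by decide, by decide⟩

/-- Move 10 → 11 of the witness play (END into chart `2`). [folklore] -/
theorem step_P_10 : Step₂ 3 (P 10) (P 11) :=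
  ⟨true, _, 2, IsCentre₂.end_ {2} (by decide), by decide, by decide, by decide, by decide⟩

/-- Move 11 → 12 of the witness play (ARR into chart `1`). [folklore] -/
theorem step_P_11 : Step₂ 3 (P 11) (P 12) :=
  ⟨false, _, 1, IsCentre₂.arr {{0, 2}, {1, 2}} (by decide) (by decide), by decide, by decide, by decide, by decide⟩

/-- Move 12 → 13 of the witness play (END into chart `0`). [folklore] -/
theorem step_P_12 : Step₂ 3 (P 12) (P 13) :=
  ⟨true, _, 0, IsCentre₂.end_ {0, 2} (by decide), by decide, by decide, by decide, by decide⟩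

/-- Move 13 → 14 of the witness play (END into chart `1`). [folklore] -/
theorem step_P_13 : Step₂ 3 (P 13) (P 14) :=
  ⟨true, _, 1, IsCentre₂.end_ {1} (by decide), by decide, by decide, by decide, by decide⟩

/-- Move 14 → 15 of the witness play (ARR into chart `0`). [folklore] -/
theorem step_P_14 : Step₂ 3 (P 14) (P 15) :=
  ⟨false, _, 0, IsCentre₂.arr {{0, 1}, {1, 2}} (by decide) (by decide), by decide, by decide, by decide, by decide⟩

/-- Move 15 → 16 of the witness play (END into chart `2`). [folklore] -/
theorem step_P_15 : Step₂ 3 (P 15) (P 16) :=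
  ⟨true, _, 2, IsCentre₂.end_ {1, 2} (by decide), by decide, by decide, by decide, by decide⟩

/-- Move 16 → 17 of the witness play (END into chart `2`). [folklore] -/
theorem step_P_16 : Step₂ 3 (P 16) (P 17) :=
  ⟨true, _, 2, IsCentre₂.end_ {1, 2} (by decide), by decide, by decide, by decide, by decide⟩

/-- Move 17 → 18 of the witness play (END into chart `1`). [folklore] -/
theorem step_P_17 : Step₂ 3 (P 17) (P 18) :=
  ⟨true, _, 1, IsCentre₂.end_ {1, 2} (by decide), by decide, by decide, by decide, by decide⟩

/-- Move 18 → 19 of the witness play (END into chart `0`). [folklore] -/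
theorem step_P_18 : Step₂ 3 (P 18) (P 19) :=
  ⟨true, _, 0, IsCentre₂.end_ {0} (by decide), by decide, by decide, by decide, by decide⟩

/-- Move 19 → 20 of the witness play (ARR into chart `1`). [folklore] -/
theorem step_P_19 : Step₂ 3 (P 19) (P 20) :=
  ⟨false, _, 1, IsCentre₂.arr {{0, 1}, {0, 2}} (by decide) (by decide), by decide, by decide, by decide, by decide⟩

/-- Move 20 → 21 of the witness play (END into chart `2`). [folklore] -/
theorem step_P_20 : Step₂ 3 (P 20) (P 21) :=
  ⟨true, _, 2, IsCentre₂.end_ {0, 2} (by decide), by decide, by decide, by decide, by decide⟩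

/-- Move 21 → 22 of the witness play (END into chart `0`). [folklore] -/
theorem step_P_21 : Step₂ 3 (P 21) (P 22) :=
  ⟨true, _, 0, IsCentre₂.end_ {0, 2} (by decide), by decide, by decide, by decide, by decide⟩

/-- Move 22 → 23 of the witness play (END into chart `1`). [folklore] -/
theorem step_P_22 : Step₂ 3 (P 22) (P 23) :=
  ⟨true, _, 1, IsCentre₂.end_ {1} (by decide), by decide, by decide, by decide, by decide⟩

/-- Move 23 → 24 of the witness play (ARR into chart `0`). [folklore] -/
theorem step_P_23 : Step₂ 3 (P 23) (P 24) :=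
  ⟨false, _, 0, IsCentre₂.arr {{0, 1}, {1, 2}} (by decide) (by decide), by decide, by decide, by decide, by decide⟩

/-! ## The infinite play and the refutation -/

/-- [OURS · L1 W4.2] The eventually periodic infinite play: the 16 transient positions, then the 8-cycle with all labels raised by
`4` per period. [folklore] -/
def play (n : ℕ) : State₂ :=
  if n < 16 then P n else (P (16 + (n - 16) % 8)).addLabels (4 * ((n - 16) / 8))

/-- The transient and the first period, move by move. [folklore] -/
theorem step_P (n : ℕ) (hn : n < 24) : Step₂ 3 (P n) (P (n + 1)) := by
  interval_cases n
  exacts [step_P_0, step_P_1, step_P_2, step_P_3, step_P_4, step_P_5, step_P_6, step_P_7, step_P_8, step_P_9, step_P_10,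
    step_P_11, step_P_12, step_P_13, step_P_14, step_P_15, step_P_16, step_P_17, step_P_18, step_P_19, step_P_20, step_P_21,
    step_P_22, step_P_23]

/-- **Every position of `play` moves to the next.** [folklore] -/
theorem step_play (n : ℕ) : Step₂ 3 (play n) (play (n + 1)) := by
  by_cases h15 : n < 15
  · have h1 : play n = P n := by simp [play, show n < 16 by omega]
    have h2 : play (n + 1) = P (n + 1) := by simp [play, show n + 1 < 16 by omega]
    rw [h1, h2]; exact step_P n (by omega)
  by_cases h16 : n = 15
  · subst h16
    have h1 : play 15 = P 15 := by simp [play]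
    have h2 : play 16 = P 16 := by simp [play, addLabels_zero]
    rw [h1, h2]; exact step_P 15 (by omega)
  -- inside the cycle: n = 16 + 8 q + r
  have hn : 16 ≤ n := by omega
  set q := (n - 16) / 8 with hq
  set r := (n - 16) % 8 with hr
  have hr8 : r < 8 := Nat.mod_lt _ (by omega)
  have hplay : play n = (P (16 + r)).addLabels (4 * q) := by simp [play, show ¬ n < 16 by omega, hq, hr]
  by_cases h7 : r < 7
  · have hq' : (n + 1 - 16) / 8 = q := by omega
    have hr' : (n + 1 - 16) % 8 = r + 1 := by omega
    have hplay' : play (n + 1) = (P (16 + (r + 1))).addLabels (4 * q) := by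
      simp only [play, if_neg (show ¬ n + 1 < 16 by omega)]
      rw [hr', hq']
    rw [hplay, hplay', ← Nat.add_assoc]
    exact step₂_addLabels (4 * q) (step_P (16 + r) (by omega))
  · have hr7 : r = 7 := by omega
    have hq' : (n + 1 - 16) / 8 = q + 1 := by omega
    have hr' : (n + 1 - 16) % 8 = 0 := by omega
    have hplay' : play (n + 1) = (P 16).addLabels (4 * (q + 1)) := by
      simp only [play, if_neg (show ¬ n + 1 < 16 by omega)]
      rw [hr', hq']
    rw [hplay, hplay', hr7, show 4 * (q + 1) = 4 + 4 * q by omega, ← addLabels_addLabels]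
    exact step₂_addLabels (4 * q) (step_P 23 (by omega))

/-- **[OURS · L1 W4.2] An infinite play from the honest initial position of `y³ + x₃⁵ + x₁⁶x₂⁶x₃` (all labels `0`).** [folklore] -/
theorem exists_infinite_play₂ :
    ∃ f : ℕ → State₂, f 0 = ⟨![0, 0, 5], ![6, 6, 1], fun _ => 0⟩ ∧ ∀ n, Step₂ 3 (f n) (f (n + 1)) :=
  ⟨play, by simp [play, P], step_play⟩

/-- **[OURS · L1 W4.2] The CJS label strategy LOSES the two-vertex polyhedra game in dimension 3** (`m = 3`): the move relation
`Step₂ 3` is not well-founded. Kernel twin of the k13-type candidate kill (memo KILL-CANDIDATE-W42-trinomial.md; engine kit j273490);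
a theorem about the model, NOT about schemes, NOT a statement of the manuscript. [folklore] -/
theorem not_labelStrategyWins₂_three : ¬ LabelStrategyWins₂ 3 := by
  intro h
  have key : ∀ s, Acc (flip (Step₂ 3)) s → ∀ n, play n ≠ s := by
    intro s hacc
    induction hacc with
    | intro s _ ih => intro n hn; exact ih (play (n + 1)) (hn ▸ step_play n) (n + 1) rfl
  exact key (play 0) (h.apply (play 0)) 0 rfl

end CampaignW42.VertexGame

end Summit.ResolutionOfSingularities.ResolutionOfSingularities.Theorems
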